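import Summits.CriticalPhenomena.PercolationContinuityZ3.Theorems.PercNearOneGluingNoHeavyRsw3InwardContinuationChain
import HarnessLib

/-!
# RSW3 lane (P2, gen 16): INWARD CONTINUATION IN COLUMNS AT `p_c(ℤ³)` ⇒ `GeometricHardCrossingLowerBound` — the engine and the theorem

builds on p205010 (kernel theorem, internal audit signed; external expert review pending) — NOT used in this file.

Cell `prim-rsw3`, prover seat `prim-rsw3-p2` (gen 16), memo `run/shared/lean/prim/rsw3/P2-RSWLITE.md` §23.
Support file (`--supports stmt-CriticalPhenomena-4575`); no definitions, no named facts, no sorries.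

Continuation of `…Rsw3InwardContinuationChain`: the column engine re-run from the inward-continuation inequality (IC_κ)
`κ · P_p[Y ↔ ∂ⁱⁿΛ_c(sm) in Z] ≤ P_p[Λ_c(m) ↔ Y in Z]` (columns `Z`, top faces `Y`, admissible centres `c`) alone —
`pow_mul_div_le_real_boxCross_of_inwardContinuation` (every `p`) — and the `p_c` theorem
**`geometricHardCrossingLowerBound_of_inwardContinuation`**: (IC_κ) at `p_c(ℤ³)` with one `κ > 0` (aspect `(s,L)`, `2 ≤ s ≤ L`, all scales and columns)
⇒ `Crossing.GeometricHardCrossingLowerBound`; plus `inwardContinuation_criticalProbI_of_setToSetQuasiMultAspectAt` ((A2)□ ⇒ (IC_κ) with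
`κ = ϰ·(6(4s)²)⁻¹`, recovering `geometricHardCrossingLowerBound_of_setToSetQuasiMultAspectAt`).  CENSUS READING (suggestion): the ratio
`P̂[top ↔ Λ_c(m) in Z] / P̂[top ↔ ∂ⁱⁿΛ_c(sm) in Z]` on columns at `p ≈ p_c(ℤ³)`.

References: Kesten 1982 §3.3 Comment (v), Thm. 5.1 [Kesten1982]; Basu–Sapozhnikov, ECP 22 (2017) no. 26, §1 (A2) [BasuSapozhnikov2017ECP]. [folklore]
-/

noncomputable section

namespace Summit.CriticalPhenomena.PercolationContinuityZ3.Theorems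

namespace Rsw3

open MeasureTheory Literature.Probability.LatticeModels Literature.Probability.Percolation
open SurfaceTension Crossing SimpleGraph

/-! ## The every-`p` engine under inward continuation (`ℤ³`) -/

/-- **THE EVERY-`p` ENGINE UNDER INWARD CONTINUATION.**  Bond percolation on `ℤ³`, any `p`; `2 ≤ s ≤ L`, `κ ≥ 0`, `m ≥ 1`, `t, K`; a block
`{0..N} × {0..W}²` (`N ≥ 1`) with `W ≥ 2Lm + sm + (2sm+1)t` and `N + m ≤ Lm + 1 + K(s-1)m`.  HYPOTHESIS (only for the columns `Z = [z, N] × [0, W]²`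
of this block of HEIGHT `N - z ≤ 2Lm + 1 + K(s-1)m` and their top face `Y`): for every centre `c` with `Λ_c(Lm) ⊆ Z` below `Y`, `κ · P_p[Y ↔ ∂ⁱⁿΛ_c(sm) in Z] ≤ P_p[Λ_c(m) ↔ Y in Z]` — a
top-to-sphere crossing CONTINUES INWARD to the core `Λ_c(m)` with conditional probability `≥ κ`.  CONCLUSION:
`κ^(K+1) · P_p(boxCross ![(L-s)m+1, ℓ, ℓ] 0) / (t+1)² ≤ P_p(boxCross ![N, W, W] 0)`, `ℓ = (2sm+1)(t+1) - 1` (an EASY shape).  Same column, patches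
and last exit as `pow_mul_div_le_real_boxCross_of_setToSetQuasiMultAspectAt`, whose hypothesis (A2)□ gives this one with `κ = ϰ·u_p(m, sm)`.
[cite: Kesten1982, §3.3 Comment (v)] [cite: BasuSapozhnikov2017ECP, §1 assumption (A2)] -/
theorem pow_mul_div_le_real_boxCross_of_inwardContinuation {p : unitInterval} {s L : ℕ} {κ : ℝ}
    (hκ : 0 ≤ κ) (hs : 2 ≤ s) (hsL : s ≤ L) {m : ℕ} (hm : 1 ≤ m)
    (t K : ℕ) {N W : ℕ} (hN : 1 ≤ N) (hW : 2 * L * m + s * m + (2 * s * m + 1) * t ≤ W)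
    (hK : N + m ≤ L * m + 1 + K * ((s - 1) * m))
    (hHC : ∀ zlo : ℤ, (N : ℤ) - zlo ≤ ((2 * L * m + 1 + K * ((s - 1) * m) : ℕ) : ℤ) → ∀ c : Site 3,
      GM.ball c (L * m) ⊆ Finset.Icc (![zlo, 0, 0] : Site 3) ![(N : ℤ), W, W] →
      (Finset.Icc (![zlo, 0, 0] : Site 3) ![(N : ℤ), W, W]).filter (fun y : Site 3 => y 0 = (N : ℤ)) ⊆
        Finset.Icc (![zlo, 0, 0] : Site 3) ![(N : ℤ), W, W] \ GM.ball c (L * m) →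
      κ * (bondPercolation (zdGraph 3) p).real
          (openCrossing (↑(Finset.Icc (![zlo, 0, 0] : Site 3) ![(N : ℤ), W, W]) : Set (Site 3))
            ↑((Finset.Icc (![zlo, 0, 0] : Site 3) ![(N : ℤ), W, W]).filter (fun y : Site 3 => y 0 = (N : ℤ)))
            ↑(innerBoundary (zdGraph 3) (GM.ball c (s * m)))) ≤
        (bondPercolation (zdGraph 3) p).real
          (openCrossing (↑(Finset.Icc (![zlo, 0, 0] : Site 3) ![(N : ℤ), W, W]) : Set (Site 3)) ↑(GM.ball c m)
            ↑((Finset.Icc (![zlo, 0, 0] : Site 3) ![(N : ℤ), W, W]).filter (fun y : Site 3 => y 0 = (N : ℤ))))) :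
    κ ^ (K + 1) *
          (bondPercolation (zdGraph 3) p).real
            (boxCross ![(((L - s) * m + 1 : ℕ) : ℤ), ((2 * s * m + 1) * (t + 1) - 1 : ℕ), ((2 * s * m + 1) * (t + 1) - 1 : ℕ)] 0) /
        ((t : ℝ) + 1) ^ 2 ≤
      (bondPercolation (zdGraph 3) p).real (boxCross ![(N : ℤ), W, W] 0) := by
  classical
  -- integer bookkeeping: `L = s + j`, `δ = (s-1) m`
  obtain ⟨j, rfl⟩ : ∃ j, L = s + j := ⟨L - s, by omega⟩
  have hLs : s + j - s = j := by omega
  rw [hLs]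
  set μ := bondPercolation (zdGraph 3) p with hμ
  set δ : ℕ := (s - 1) * m with hδ
  have hδ' : (δ : ℤ) + m = s * m := by
    rw [hδ]; obtain ⟨s', rfl⟩ : ∃ s', s = s' + 1 := ⟨s - 1, by omega⟩
    simp only [Nat.add_sub_cancel]; push_cast; ring
  have hm1 : (1 : ℤ) ≤ m := by exact_mod_cast hm
  have hm0 : (0 : ℤ) ≤ m := by positivity
  have hj0 : (0 : ℤ) ≤ (j : ℤ) * m := by positivity
  have hs0 : (0 : ℤ) ≤ (s : ℤ) * m := by positivity
  have hδ0 : (0 : ℤ) ≤ δ := by positivity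
  have hW' : 2 * ((s : ℤ) * m) + 2 * ((j : ℤ) * m) + (s : ℤ) * m + (2 * ((s : ℤ) * m) + 1) * t ≤ W := by
    have := (Nat.cast_le (α := ℤ)).2 hW; push_cast at this; linarith
  have hK' : (N : ℤ) + m ≤ (s : ℤ) * m + (j : ℤ) * m + 1 + K * δ := by
    have := (Nat.cast_le (α := ℤ)).2 hK; push_cast at this; linarith
  -- the patch
  obtain ⟨a, b, hat, hbt, hpatch⟩ := exists_le_real_openCrossing_patch p (j * m + 1) (2 * s * m) t
  have hat' : (a : ℤ) ≤ t := by exact_mod_cast hat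
  have hbt' : (b : ℤ) ≤ t := by exact_mod_cast hbt
  have ha0 : (0 : ℤ) ≤ (2 * ((s : ℤ) * m) + 1) * a := by positivity
  have hb0 : (0 : ℤ) ≤ (2 * ((s : ℤ) * m) + 1) * b := by positivity
  have haT : (2 * ((s : ℤ) * m) + 1) * a ≤ (2 * ((s : ℤ) * m) + 1) * t := mul_le_mul_of_nonneg_left hat' (by positivity)
  have hbT : (2 * ((s : ℤ) * m) + 1) * b ≤ (2 * ((s : ℤ) * m) + 1) * t := mul_le_mul_of_nonneg_left hbt' (by positivity)
  have hℓ' : (((2 * s * m + 1) * (t + 1) - 1 : ℕ) : ℤ) = (2 * ((s : ℤ) * m) + 1) * t + 2 * ((s : ℤ) * m) := by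
    have : 1 ≤ (2 * s * m + 1) * (t + 1) := Nat.one_le_iff_ne_zero.2 (by positivity)
    push_cast [Nat.cast_sub this]; ring
  -- the centres of the chain, the column and its top face
  set z0 : ℤ := (N : ℤ) - (s : ℤ) * m - (j : ℤ) * m - 1 - K * δ with hz0
  set o : ℤ := (s : ℤ) * m + (j : ℤ) * m + (s : ℤ) * m with ho
  set c : ℕ → Site 3 := fun k => ![z0 + k * δ, o + (2 * ((s : ℤ) * m) + 1) * a, o + (2 * ((s : ℤ) * m) + 1) * b] with hc
  set zlo : ℤ := z0 - (s : ℤ) * m - (j : ℤ) * m with hzlo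
  set Z : Finset (Site 3) := Finset.Icc (![zlo, 0, 0] : Site 3) ![(N : ℤ), W, W] with hZ
  set Y : Finset (Site 3) := Z.filter (fun y : Site 3 => y 0 = (N : ℤ)) with hY
  have hkK : ∀ k : ℕ, k ≤ K → (k : ℤ) * δ ≤ K * δ := fun k hk =>
    mul_le_mul_of_nonneg_right (by exact_mod_cast hk) hδ0
  have hLm : (((s + j) * m : ℕ) : ℤ) = (s : ℤ) * m + (j : ℤ) * m := by push_cast; ring
  have hsm : ((s * m : ℕ) : ℤ) = (s : ℤ) * m := by push_cast; ring
  -- hypotheses of the chain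
  have hstep : ∀ k, k < K → GM.ball (c (k + 1)) m ⊆ GM.ball (c k) (s * m) := by
    intro k hk v hv
    simp only [hc] at hv ⊢
    rw [mem_ball_vec3_iff] at hv ⊢
    rw [hsm]
    push_cast at hv ⊢
    obtain ⟨⟨h0, h0'⟩, ⟨h1, h1'⟩, ⟨h2, h2'⟩⟩ := hv
    refine ⟨⟨by linarith, by linarith⟩, ⟨by linarith, by linarith⟩, ⟨by linarith, by linarith⟩⟩
  have hballZ : ∀ k, k ≤ K → GM.ball (c k) ((s + j) * m) ⊆ Z := by
    intro k hk v hv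
    simp only [hc] at hv
    rw [mem_ball_vec3_iff, hLm] at hv
    obtain ⟨⟨h0, h0'⟩, ⟨h1, h1'⟩, ⟨h2, h2'⟩⟩ := hv
    have hk' := hkK k hk
    have hk0 : (0 : ℤ) ≤ (k : ℤ) * δ := by positivity
    rw [hZ, mem_Icc_vec3_iff]
    simp only [Matrix.cons_val_zero, Matrix.cons_val_one, Matrix.head_cons, Matrix.cons_val_two, Matrix.tail_cons]
    refine ⟨⟨by linarith, by linarith⟩, ⟨by linarith, by linarith⟩, ⟨by linarith, by linarith⟩⟩
  have hYball : ∀ k, k ≤ K → Y ⊆ Z \ GM.ball (c k) ((s + j) * m) := by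
    intro k hk y hy
    rw [hY, Finset.mem_filter] at hy
    refine Finset.mem_sdiff.2 ⟨hy.1, fun hyb => ?_⟩
    simp only [hc] at hyb
    rw [mem_ball_vec3_iff, hLm, hy.2] at hyb
    linarith [hyb.1.2, hkK k hk]
  -- THE CHAIN (abstract inward continuation along the column)
  have hheight : (N : ℤ) - zlo ≤ ((2 * (s + j) * m + 1 + K * δ : ℕ) : ℤ) := by
    rw [hzlo, hz0]; push_cast; linarith
  have hHCZ : ∀ c' : Site 3, GM.ball c' ((s + j) * m) ⊆ Z → Y ⊆ Z \ GM.ball c' ((s + j) * m) →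
      κ * μ.real (openCrossing (↑Z : Set (Site 3)) ↑Y ↑(innerBoundary (zdGraph 3) (GM.ball c' (s * m)))) ≤
        μ.real (openCrossing (↑Z : Set (Site 3)) ↑(GM.ball c' m) ↑Y) := fun c' h1 h2 => hHC zlo hheight c' h1 h2
  have hchain := pow_succ_mul_real_openCrossing_innerBoundary_le_of_inwardContinuation (p := p) hκ
    (Nat.le_add_right s j) Z Y hHCZ K c hstep hballZ hYball
  -- the top: the easy crossing of the translated block lands in the patch below `c K`
  set vsh : Site 3 := ![(N : ℤ) - (j * m + 1 : ℕ), (s : ℤ) * m + (j : ℤ) * m, (s : ℤ) * m + (j : ℤ) * m] with hvsh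
  set φ : zdGraph 3 ≃g zdGraph 3 := zdShiftIso vsh with hφ
  set M : Site 3 := ![((j * m + 1 : ℕ) : ℤ), ((2 * s * m + 1) * (t + 1) - 1 : ℕ), ((2 * s * m + 1) * (t + 1) - 1 : ℕ)] with hM
  have hjm : ((j * m + 1 : ℕ) : ℤ) = (j : ℤ) * m + 1 := by push_cast; ring
  have hNh : (N : ℤ) - (j * m + 1 : ℕ) = z0 + K * δ + (s : ℤ) * m := by
    rw [hz0, hjm]; ring
  have htop : μ.real (openCrossing (↑(Finset.Icc (0 : Site 3) M) : Set (Site 3))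
      {y | y ∈ Finset.Icc (0 : Site 3) M ∧ y 0 = (j * m + 1 : ℕ)}
      {x | x ∈ Finset.Icc (0 : Site 3) M ∧ x 0 = 0 ∧
        (((2 * s * m : ℕ) : ℤ) + 1) * a ≤ x 1 ∧ x 1 ≤ (((2 * s * m : ℕ) : ℤ) + 1) * a + (2 * s * m : ℕ) ∧
        (((2 * s * m : ℕ) : ℤ) + 1) * b ≤ x 2 ∧ x 2 ≤ (((2 * s * m : ℕ) : ℤ) + 1) * b + (2 * s * m : ℕ)}) ≤
      μ.real (openCrossing (↑Z : Set (Site 3)) ↑Y ↑(innerBoundary (zdGraph 3) (GM.ball (c K) (s * m)))) := by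
    rw [hμ, ← bondPercolation_real_image φ p]
    have h2sm : ((2 * s * m : ℕ) : ℤ) = 2 * ((s : ℤ) * m) := by push_cast; ring
    -- coordinates of the translated block
    have hb0 : M 0 = (j : ℤ) * m + 1 := by simp only [hM, Matrix.cons_val_zero, hjm]
    have hb1 : M 1 = (2 * ((s : ℤ) * m) + 1) * t + 2 * ((s : ℤ) * m) := by
      simp only [hM, Matrix.cons_val_one, Matrix.cons_val_zero, hℓ']
    have hb2 : M 2 = (2 * ((s : ℤ) * m) + 1) * t + 2 * ((s : ℤ) * m) := by
      simp only [hM, Matrix.cons_val_two, Matrix.tail_cons, Matrix.head_cons, hℓ']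
    have hφv : ∀ v : Site 3, (φ : Site 3 → Site 3) v = v + vsh := fun v => rfl
    have e0 : ∀ v : Site 3, (v + vsh) 0 = v 0 + (z0 + K * δ + (s : ℤ) * m) := fun v => by
      rw [Pi.add_apply, hvsh, Matrix.cons_val_zero, hNh]
    have e1 : ∀ v : Site 3, (v + vsh) 1 = v 1 + ((s : ℤ) * m + (j : ℤ) * m) := fun v => by
      simp only [Pi.add_apply, hvsh, Matrix.cons_val_one, Matrix.cons_val_zero]
    have e2 : ∀ v : Site 3, (v + vsh) 2 = v 2 + ((s : ℤ) * m + (j : ℤ) * m) := fun v => by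
      simp only [Pi.add_apply, hvsh, Matrix.cons_val_two, Matrix.tail_cons, Matrix.head_cons]
    have hK0 : (0 : ℤ) ≤ (K : ℤ) * δ := by positivity
    have hmemZ : ∀ v : Site 3, v ∈ Finset.Icc (0 : Site 3) M → v + vsh ∈ Z := by
      intro v hv
      rw [mem_Icc_vec3_iff, hb0, hb1, hb2] at hv
      simp only [Pi.zero_apply] at hv
      obtain ⟨⟨h0, h0'⟩, ⟨h1, h1'⟩, ⟨h2, h2'⟩⟩ := hv
      rw [hZ, mem_Icc_vec3_iff, e0 v, e1 v, e2 v]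
      simp only [Matrix.cons_val_zero, Matrix.cons_val_one, Matrix.head_cons, Matrix.cons_val_two, Matrix.tail_cons]
      refine ⟨⟨by linarith only [hzlo, h0, hK0, hs0, hj0], by linarith only [hz0, h0']⟩,
        ⟨by linarith only [h1, hs0, hj0], by linarith only [h1', hW', hj0]⟩,
        ⟨by linarith only [h2, hs0, hj0], by linarith only [h2', hW', hj0]⟩⟩
    refine measureReal_mono (openCrossing_mono ?_ ?_ ?_) (measure_ne_top _ _)
    · rintro _ ⟨v, hv, rfl⟩
      rw [hφv, Finset.mem_coe]
      exact hmemZ v (Finset.mem_coe.1 hv)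
    · rintro _ ⟨v, ⟨hv, hv0⟩, rfl⟩
      rw [hφv, Finset.mem_coe, hY, Finset.mem_filter]
      refine ⟨hmemZ v hv, ?_⟩
      rw [e0, hv0, hz0]; push_cast; ring
    · rintro _ ⟨v, ⟨hv, hv0, hv1, hv1', hv2, hv2'⟩, rfl⟩
      rw [h2sm] at hv1 hv1' hv2 hv2'
      rw [hφv, Finset.mem_coe, mem_innerBoundary_iff]
      have hvball : v + vsh ∈ GM.ball (c K) (s * m) := by
        simp only [hc]
        rw [mem_ball_vec3_iff, hsm, e0 v, e1 v, e2 v, hv0, ho]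
        refine ⟨⟨by linarith only [hs0], by linarith only [hs0]⟩, ⟨by linarith only [hv1], by linarith only [hv1']⟩,
          ⟨by linarith only [hv2], by linarith only [hv2']⟩⟩
      refine ⟨hvball, v + vsh + Pi.single 0 1, fun hmem => ?_, ?_⟩
      · simp only [hc] at hmem
        rw [mem_ball_vec3_iff, hsm] at hmem
        have h00 := hmem.1.2
        rw [Pi.add_apply, e0 v, hv0, Pi.single_eq_same] at h00
        linarith only [h00]
      · exact (zdGraph_adj_iff _ _).2 ⟨0, Or.inl rfl⟩
  -- the bottom: last exit through the bottom face
  have hbot : μ.real (openCrossing (↑Z : Set (Site 3)) ↑(GM.ball (c 0) m) ↑Y) ≤ μ.real (boxCross ![(N : ℤ), W, W] 0) := by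
    refine DCT16.real_mono_of_forall_subset_edgeSet (zdGraph 3) p fun ω hω hmem => ?_
    obtain ⟨x, hx, y, hy, hxy⟩ := hmem
    rw [Finset.mem_coe] at hx hy
    simp only [hc] at hx
    rw [mem_ball_vec3_iff] at hx
    rw [hY, Finset.mem_filter] at hy
    have hx0 : x 0 ≤ 0 := by push_cast at hx; linarith [hx.1.2]
    exact mem_boxCross_of_mem_openConnIn_column hN hx0 hy.1 hy.2 hω hxy
  -- assemble
  have hq : 0 ≤ κ ^ (K + 1) := pow_nonneg hκ _
  calc κ ^ (K + 1) * μ.real (boxCross M 0) / ((t : ℝ) + 1) ^ 2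
      = κ ^ (K + 1) * (μ.real (boxCross M 0) / ((t : ℝ) + 1) ^ 2) := by ring
    _ ≤ κ ^ (K + 1) *
          μ.real (openCrossing (↑Z : Set (Site 3)) ↑Y ↑(innerBoundary (zdGraph 3) (GM.ball (c K) (s * m)))) :=
        mul_le_mul_of_nonneg_left (hpatch.trans htop) hq
    _ ≤ μ.real (openCrossing (↑Z : Set (Site 3)) ↑(GM.ball (c 0) m) ↑Y) := hchain
    _ ≤ μ.real (boxCross ![(N : ℤ), W, W] 0) := hbot


/-! ## At `p_c(ℤ³)`: inward continuation ⇒ geometric hard-crossing lower bounds -/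

/-- **INWARD CONTINUATION IN COLUMNS OF BOUNDED HEIGHT ⇒ HARD CROSSINGS AT EACH ASPECT, with ONE constant geometric in the aspect.**  Fix `2 ≤ s ≤ L`
and `κ > 0`.  There is `c = c(κ, s, L) > 0` such that for every `K ≥ 1`: IF for every scale `m ≥ 1`, every column `Z = [z, N] × [0, W]²` of `ℤ³` of height
`N - z ≤ 2Lm + 1 + (2KD+1)(s-1)m` (`D = 2L + s + 2s(3L) + 3L`) with top face `Y = Z ∩ {x₀ = N}`, and every centre `c'` with `Λ_{c'}(Lm) ⊆ Z`, `Y ∩ Λ_{c'}(Lm) = ∅`,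
`κ · P_{p_c}[Y ↔ ∂ⁱⁿΛ_{c'}(sm) in Z] ≤ P_{p_c}[Λ_{c'}(m) ↔ Y in Z]`, THEN `c^K ≤ P_{p_c}(boxCross (hardShape K n) 0)` for all `n ≥ 1`.  Constants: `t = 3L`,
`m = ⌊n/D⌋`, chain length `2KD + 1`, `e₀ = 85⁻³/(3·9³)` (easy brick `1:3`), small sides by a straight open segment; `c = min(q²e₀(t+1)⁻²·q^{2D}, p_c^D)`, `q = min(κ,1)`.
`θ(p_c) = 0` is not used.  (The height bound is what makes the dictionary `…Rsw3InwardContinuationDictionary` two-sided.)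
[cite: Kesten1982, §3.3 Comment (v) and Thm. 5.1] [cite: BasuSapozhnikov2017ECP, §1 assumption (A2)] -/
theorem exists_forall_pow_le_real_boxCross_of_inwardContinuation {s L : ℕ} (hs : 2 ≤ s) (hsL : s ≤ L) {κ : ℝ} (hκ : 0 < κ) :
    ∃ c : ℝ, 0 < c ∧ ∀ K : ℕ, 1 ≤ K →
      (∀ m : ℕ, 1 ≤ m → ∀ zlo : ℤ, ∀ N W : ℕ,
        (N : ℤ) - zlo ≤ ((2 * L * m + 1 + (2 * K * (2 * L + s + 2 * s * (3 * L) + 3 * L) + 1) * ((s - 1) * m) : ℕ) : ℤ) →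
        ∀ c' : Site 3,
        GM.ball c' (L * m) ⊆ Finset.Icc (![zlo, 0, 0] : Site 3) ![(N : ℤ), W, W] →
        (Finset.Icc (![zlo, 0, 0] : Site 3) ![(N : ℤ), W, W]).filter (fun y : Site 3 => y 0 = (N : ℤ)) ⊆
          Finset.Icc (![zlo, 0, 0] : Site 3) ![(N : ℤ), W, W] \ GM.ball c' (L * m) →
        κ * (bondPercolation (zdGraph 3) (criticalProbI 3)).real
            (openCrossing (↑(Finset.Icc (![zlo, 0, 0] : Site 3) ![(N : ℤ), W, W]) : Set (Site 3))
              ↑((Finset.Icc (![zlo, 0, 0] : Site 3) ![(N : ℤ), W, W]).filter (fun y : Site 3 => y 0 = (N : ℤ)))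
              ↑(innerBoundary (zdGraph 3) (GM.ball c' (s * m)))) ≤
          (bondPercolation (zdGraph 3) (criticalProbI 3)).real
            (openCrossing (↑(Finset.Icc (![zlo, 0, 0] : Site 3) ![(N : ℤ), W, W]) : Set (Site 3)) ↑(GM.ball c' m)
              ↑((Finset.Icc (![zlo, 0, 0] : Site 3) ![(N : ℤ), W, W]).filter (fun y : Site 3 => y 0 = (N : ℤ))))) →
      ∀ n : ℕ, 1 ≤ n → c ^ K ≤ (bondPercolation (zdGraph 3) (criticalProbI 3)).real (boxCross (hardShape K n) 0) := by
  classical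
  set pc : unitInterval := criticalProbI 3 with hpc
  have hpc0 : (0 : ℝ) < pc := by rw [hpc, coe_criticalProbI]; exact criticalProb_zd_pos 3 (by norm_num)
  have hpc1 : (pc : ℝ) ≤ 1 := pc.2.2
  -- WLOG `κ ≤ 1`
  set q : ℝ := min κ 1 with hq
  have hq0 : 0 < q := lt_min hκ one_pos
  have hq1 : q ≤ 1 := min_le_right _ _
  -- shape constants
  set t : ℕ := 3 * L with ht
  set D : ℕ := 2 * L + s + 2 * s * t + t with hD
  have hL2 : 2 ≤ L := le_trans hs hsL
  have hD1 : 1 ≤ D := by omega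
  -- the easy brick `1 : 3`
  set e₀ : ℝ := ((85 : ℝ) ^ 3)⁻¹ / (3 * (4 * 1 + 5) ^ 3) with he₀
  have he₀0 : 0 < e₀ := by positivity
  have he₀1 : e₀ ≤ 1 := by rw [he₀]; norm_num
  have he : ∀ m : ℕ, 1 ≤ m → e₀ ≤ (bondPercolation (zdGraph 3) pc).real
      (boxCross ![(((L - s) * m + 1 : ℕ) : ℤ), ((2 * s * m + 1) * (t + 1) - 1 : ℕ), ((2 * s * m + 1) * (t + 1) - 1 : ℕ)] 0) := by
    intro m hm
    have hwid : (1 + 2) * ((L - s) * m + 1) ≤ (2 * s * m + 1) * (t + 1) - 1 := by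
      have h1 : (L - s) * m ≤ L * m := Nat.mul_le_mul_right m (Nat.sub_le L s)
      have h2 : 2 * (L * m) ≤ s * (L * m) := Nat.mul_le_mul_right _ hs
      have h3 : (2 * s * m + 1) * (t + 1) = 6 * (s * (L * m)) + 2 * (s * m) + 3 * L + 1 := by rw [ht]; ring
      omega
    have h' := le_boxCrossProb_of_brick (r := 1) (u := (L - s) * m + 1) (n := (L - s) * m + 1) le_rfl (by omega) (by omega) hwid
    rw [Nat.cast_one] at h'
    exact h'
  -- the constant
  have ht1 : (1 : ℝ) ≤ (t : ℝ) + 1 := by linarith [(Nat.cast_nonneg t : (0 : ℝ) ≤ t)]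
  set A : ℝ := q ^ 2 * e₀ / ((t : ℝ) + 1) ^ 2 with hA
  have hA0 : 0 < A := by positivity
  have hA1 : A ≤ 1 := by
    rw [hA, div_le_one (by positivity)]
    calc q ^ 2 * e₀ ≤ 1 * 1 := mul_le_mul (pow_le_one₀ hq0.le hq1) he₀1 he₀0.le zero_le_one
      _ = 1 := one_mul 1
      _ ≤ ((t : ℝ) + 1) ^ 2 := one_le_pow₀ ht1
  set B : ℝ := q ^ (2 * D) with hB
  have hB0 : 0 < B := by positivity
  have hmin0 : 0 ≤ min (A * B) ((pc : ℝ) ^ D) := le_min (mul_pos hA0 hB0).le (pow_pos hpc0 D).le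
  refine ⟨min (A * B) ((pc : ℝ) ^ D), lt_min (mul_pos hA0 hB0) (pow_pos hpc0 D), fun K hK hHC n hn => ?_⟩
  -- lower the constant to `q`
  have hHC₁ : ∀ m : ℕ, 1 ≤ m → ∀ zlo : ℤ, ∀ N W : ℕ,
      (N : ℤ) - zlo ≤ ((2 * L * m + 1 + (2 * K * D + 1) * ((s - 1) * m) : ℕ) : ℤ) → ∀ c' : Site 3,
      GM.ball c' (L * m) ⊆ Finset.Icc (![zlo, 0, 0] : Site 3) ![(N : ℤ), W, W] →
      (Finset.Icc (![zlo, 0, 0] : Site 3) ![(N : ℤ), W, W]).filter (fun y : Site 3 => y 0 = (N : ℤ)) ⊆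
        Finset.Icc (![zlo, 0, 0] : Site 3) ![(N : ℤ), W, W] \ GM.ball c' (L * m) →
      q * (bondPercolation (zdGraph 3) pc).real
          (openCrossing (↑(Finset.Icc (![zlo, 0, 0] : Site 3) ![(N : ℤ), W, W]) : Set (Site 3))
            ↑((Finset.Icc (![zlo, 0, 0] : Site 3) ![(N : ℤ), W, W]).filter (fun y : Site 3 => y 0 = (N : ℤ)))
            ↑(innerBoundary (zdGraph 3) (GM.ball c' (s * m)))) ≤
        (bondPercolation (zdGraph 3) pc).real
          (openCrossing (↑(Finset.Icc (![zlo, 0, 0] : Site 3) ![(N : ℤ), W, W]) : Set (Site 3)) ↑(GM.ball c' m)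
            ↑((Finset.Icc (![zlo, 0, 0] : Site 3) ![(N : ℤ), W, W]).filter (fun y : Site 3 => y 0 = (N : ℤ)))) :=
    fun m hm zlo N W hh c' h1 h2 => le_trans (mul_le_mul_of_nonneg_right (min_le_left _ _) measureReal_nonneg)
      (hHC m hm zlo N W hh c' h1 h2)
  have hshape : hardShape K n = ![((K * n : ℕ) : ℤ), n, n] := by
    simp only [hardShape]; push_cast; rfl
  by_cases hnD : n < D
  · -- small sides: a straight open segment of `K n ≤ K D` edges
    have hpos : ∀ i : Fin 3, 0 ≤ hardShape K n i := by
      rw [Fin.forall_fin_succ, Fin.forall_fin_two]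
      simp only [Fin.succ_zero_eq_one, Fin.succ_one_eq_two, hardShape, Matrix.cons_val_zero, Matrix.cons_val_one,
        Matrix.head_cons, Matrix.cons_val_two, Matrix.tail_cons]
      exact ⟨by positivity, by positivity, by positivity⟩
    have hseg := pow_le_real_boxCross pc hpos 0
    have h0 : (hardShape K n 0).toNat = K * n := by
      rw [hshape, Matrix.cons_val_zero, Int.toNat_natCast]
    rw [h0] at hseg
    calc (min (A * B) ((pc : ℝ) ^ D)) ^ K ≤ ((pc : ℝ) ^ D) ^ K := pow_le_pow_left₀ hmin0 (min_le_right _ _) K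
      _ = (pc : ℝ) ^ (D * K) := by rw [pow_mul]
      _ ≤ (pc : ℝ) ^ (K * n) :=
          pow_le_pow_of_le_one hpc0.le hpc1 (by rw [mul_comm D K]; exact Nat.mul_le_mul_left K hnD.le)
      _ ≤ (bondPercolation (zdGraph 3) pc).real (boxCross (hardShape K n) 0) := hseg
  · -- large sides: the engine at scale `m = ⌊n / D⌋`
    push Not at hnD
    set m : ℕ := n / D with hm
    have hm1 : 1 ≤ m := Nat.div_pos hnD (by omega)
    have hDm : D * m ≤ n := by rw [hm, mul_comm]; exact Nat.div_mul_le_self n D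
    have hnlt : n < D * m + D := by rw [hm, mul_comm]; exact Nat.lt_div_mul_add (by omega)
    set K' : ℕ := 2 * K * D + 1 with hK'
    have hW : 2 * L * m + s * m + (2 * s * m + 1) * t ≤ n := by
      have h1 : D * m = 2 * L * m + s * m + 2 * s * t * m + t * m := by rw [hD]; ring
      have h2 : t ≤ t * m := Nat.le_mul_of_pos_right t hm1
      have h3 : (2 * s * m + 1) * t = 2 * s * t * m + t := by ring
      omega
    have hKc : K * n + m ≤ L * m + 1 + K' * ((s - 1) * m) := by
      have h1 : m ≤ (s - 1) * m := Nat.le_mul_of_pos_left m (by omega)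
      have h2 : K * n ≤ K * (D * m + D) := Nat.mul_le_mul_left K hnlt.le
      have h3 : K * D ≤ K * D * m := Nat.le_mul_of_pos_right _ hm1
      have h4 : K' * m ≤ K' * ((s - 1) * m) := Nat.mul_le_mul_left K' h1
      have h5 : K' * m = 2 * (K * D * m) + m := by rw [hK']; ring
      have h6 : K * (D * m + D) = K * D * m + K * D := by ring
      omega
    have hN1 : 1 ≤ K * n := Nat.one_le_iff_ne_zero.2 (Nat.mul_ne_zero (by omega) (by omega))
    have heng := pow_mul_div_le_real_boxCross_of_inwardContinuation hq0.le hs hsL hm1 t K' hN1 hW hKc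
      (fun zlo hh c' h1 h2 => hHC₁ m hm1 zlo (K * n) n (by rw [hK'] at hh; exact hh) c' h1 h2)
    rw [hshape]
    calc (min (A * B) ((pc : ℝ) ^ D)) ^ K ≤ (A * B) ^ K := pow_le_pow_left₀ hmin0 (min_le_left _ _) K
      _ = A ^ K * B ^ K := mul_pow A B K
      _ ≤ A * B ^ K := mul_le_mul_of_nonneg_right (pow_le_of_le_one hA0.le hA1 (by omega)) (by positivity)
      _ = q ^ (K' + 1) * e₀ / ((t : ℝ) + 1) ^ 2 := by
          rw [hA, hB, hK', ← pow_mul]; ring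
      _ ≤ q ^ (K' + 1) *
            (bondPercolation (zdGraph 3) pc).real
              (boxCross ![(((L - s) * m + 1 : ℕ) : ℤ), ((2 * s * m + 1) * (t + 1) - 1 : ℕ),
                ((2 * s * m + 1) * (t + 1) - 1 : ℕ)] 0) / ((t : ℝ) + 1) ^ 2 := by
          refine div_le_div_of_nonneg_right ?_ (by positivity)
          exact mul_le_mul_of_nonneg_left (he m hm1) (pow_nonneg hq0.le _)
      _ ≤ (bondPercolation (zdGraph 3) pc).real (boxCross ![((K * n : ℕ) : ℤ), n, n] 0) := heng

/-- **INWARD CONTINUATION AT `p_c(ℤ³)` (all columns, one `κ > 0`) IMPLIES THE LOWER HALF OF 3-D RSW WITH GEOMETRIC CONSTANTS.**  Fix `2 ≤ s ≤ L` and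
`κ > 0`.  If for every scale `m ≥ 1`, every column `Z = [z, N] × [0, W]²` with top face `Y` and every centre `c` with `Λ_c(Lm) ⊆ Z`, `Y ∩ Λ_c(Lm) = ∅`:
`κ · P_{p_c}[Y ↔ ∂ⁱⁿΛ_c(sm) in Z] ≤ P_{p_c}[Λ_c(m) ↔ Y in Z]`, then `Crossing.GeometricHardCrossingLowerBound` (hence `HardCrossingLowerBound k` ∀ k, the uniform cube).
(A2)□ gives the hypothesis with `κ = ϰ·(6(4s)²)⁻¹` (`inwardContinuation_criticalProbI_of_setToSetQuasiMultAspectAt`).  `θ(p_c) = 0` is not used.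
[cite: Kesten1982, §3.3 Comment (v) and Thm. 5.1] [cite: BasuSapozhnikov2017ECP, §1 assumption (A2)] -/
theorem geometricHardCrossingLowerBound_of_inwardContinuation {s L : ℕ} (hs : 2 ≤ s) (hsL : s ≤ L) {κ : ℝ} (hκ : 0 < κ)
    (hHC : ∀ m : ℕ, 1 ≤ m → ∀ zlo : ℤ, ∀ N W : ℕ, ∀ c : Site 3,
      GM.ball c (L * m) ⊆ Finset.Icc (![zlo, 0, 0] : Site 3) ![(N : ℤ), W, W] →
      (Finset.Icc (![zlo, 0, 0] : Site 3) ![(N : ℤ), W, W]).filter (fun y : Site 3 => y 0 = (N : ℤ)) ⊆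
        Finset.Icc (![zlo, 0, 0] : Site 3) ![(N : ℤ), W, W] \ GM.ball c (L * m) →
      κ * (bondPercolation (zdGraph 3) (criticalProbI 3)).real
          (openCrossing (↑(Finset.Icc (![zlo, 0, 0] : Site 3) ![(N : ℤ), W, W]) : Set (Site 3))
            ↑((Finset.Icc (![zlo, 0, 0] : Site 3) ![(N : ℤ), W, W]).filter (fun y : Site 3 => y 0 = (N : ℤ)))
            ↑(innerBoundary (zdGraph 3) (GM.ball c (s * m)))) ≤
        (bondPercolation (zdGraph 3) (criticalProbI 3)).real
          (openCrossing (↑(Finset.Icc (![zlo, 0, 0] : Site 3) ![(N : ℤ), W, W]) : Set (Site 3)) ↑(GM.ball c m)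
            ↑((Finset.Icc (![zlo, 0, 0] : Site 3) ![(N : ℤ), W, W]).filter (fun y : Site 3 => y 0 = (N : ℤ))))) :
    GeometricHardCrossingLowerBound := by
  obtain ⟨c, hc, h⟩ := exists_forall_pow_le_real_boxCross_of_inwardContinuation hs hsL hκ
  exact ⟨c, hc, fun K n hK hn => h K hK (fun m hm zlo N W _ c' h1 h2 => hHC m hm zlo N W c' h1 h2) n hn⟩

/-- **(A2)□ at `p_c(ℤ³)` ⇒ inward continuation in columns** with `κ = ϰ·(6(4s)²)⁻¹` (`1 ≤ s ≤ L`, `ϰ ≥ 0`): the every-`p` continuation of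
`inwardContinuation_of_setToSetQuasiMultAspectAt` with the inner factor discharged by the annulus window at aspect `s`
(`le_real_boxCrossing_mul_criticalProbI`).  With `geometricHardCrossingLowerBound_of_inwardContinuation` this recovers
`geometricHardCrossingLowerBound_of_setToSetQuasiMultAspectAt`. [cite: BasuSapozhnikov2017ECP, §1 assumption (A2)] [cite: Kesten1982, Cor. 5.1] -/
theorem inwardContinuation_criticalProbI_of_setToSetQuasiMultAspectAt {s L : ℕ} (hs : 1 ≤ s) (hsL : s ≤ L) {ϰ : ℝ} (hϰ : 0 ≤ ϰ)
    (h : SetToSetQuasiMultAspectAt 3 (criticalProbI 3) s L ϰ) {m : ℕ} (hm : 1 ≤ m)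
    (Z Y : Finset (Site 3)) (c : Site 3) (hZ : GM.ball c (L * m) ⊆ Z) (hY : Y ⊆ Z \ GM.ball c (L * m)) :
    ϰ * ((2 * (3 : ℝ))⁻¹ * ((4 * (s : ℝ)) ^ (3 - 1))⁻¹) *
        (bondPercolation (zdGraph 3) (criticalProbI 3)).real
          (openCrossing (↑Z : Set (Site 3)) ↑Y ↑(innerBoundary (zdGraph 3) (GM.ball c (s * m)))) ≤
      (bondPercolation (zdGraph 3) (criticalProbI 3)).real (openCrossing (↑Z : Set (Site 3)) ↑(GM.ball c m) ↑Y) := by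
  have hu : (2 * ((3 : ℕ) : ℝ))⁻¹ * ((4 * (s : ℝ)) ^ (3 - 1))⁻¹ ≤
      (bondPercolation (zdGraph 3) (criticalProbI 3)).real (boxCrossing 3 m (s * m)) :=
    le_real_boxCrossing_mul_criticalProbI (d := 3) (by norm_num) hs hm
  have hu' : (2 * (3 : ℝ))⁻¹ * ((4 * (s : ℝ)) ^ (3 - 1))⁻¹ ≤
      (bondPercolation (zdGraph 3) (criticalProbI 3)).real (boxCrossing 3 m (s * m)) := by
    simpa using hu
  refine le_trans ?_ (inwardContinuation_of_setToSetQuasiMultAspectAt h hϰ hs hsL hm Z Y c hZ hY)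
  exact mul_le_mul_of_nonneg_right (mul_le_mul_of_nonneg_left hu' hϰ) measureReal_nonneg

end Rsw3

end Summit.CriticalPhenomena.PercolationContinuityZ3.Theorems
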